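import Summits.QuantumFields.YangMills.Theses.ThermodynamicCeilings

/-!
# Route `ThermodynamicCeilings` — the edge `WindowedSpectralMeasure → AnchoredSpectralMeasure` (LINE G is a WEAKENING)

D-0145 ideator seat ym-idea-11 (generation g6, lens «wuc»).  The crux `AnchoredSpectralMeasure` (stmt-QuantumFields-28158, LINE G)
of route `ThermodynamicCeilings` is `WindowedSpectralMeasure` (stmt-QuantumFields-27776) with the degree-8 DOUBLING clause on the
window `[E₀, 1]`, `E₀ := max (s/ℓ) (4/L)`, replaced by the ONE-ANCHOR majorant `ν([0,E)) ≤ A (E/E₀)⁸ ν([0,E₀))` for `E₀ ≤ E ≤ 1`;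
the representation clause and the Laplace-weighted UV clause are verbatim.  The edge is doubling applied once at the base point
`E₀` with `λ := E/E₀ ≥ 1` (`λ·E₀ = E ≤ 1`).  Hence every refutation of 28158 refutes 27776 (and 27501) a fortiori, and LINE G is a
genuine weakening of LINE F.  Closes nothing; no summit / leaf / NT / UV / IR statement is proved.
-/

namespace Summit.QuantumFields.YangMills.Theses.ThermodynamicCeilings

/-- **LINE G is a weakening of LINE F**: the windowed-doubling crux `WindowedSpectralMeasure` (27776) implies the one-anchor
majorant crux `AnchoredSpectralMeasure` (28158). -/
theorem anchoredSpectralMeasure_of_windowed (h : WindowedSpectralMeasure) : AnchoredSpectralMeasure := by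
  intro G _ _ _ _ hG hSU r v f g hh Λ₅
  obtain ⟨ε₀, hε₀, H⟩ := h G hG hSU r v f g hh Λ₅
  refine ⟨ε₀, hε₀, fun ε hε hεε hfl => ?_⟩
  obtain ⟨ℓM, hℓM, H1⟩ := H ε hε hεε hfl
  refine ⟨ℓM, hℓM, fun ℓ hℓ hℓℓ => ?_⟩
  obtain ⟨A, βM, hA, H2⟩ := H1 ℓ hℓ hℓℓ
  refine ⟨A, βM, hA, fun β hβ s hs hs1 hsub L q k hq => ?_⟩
  obtain ⟨ν, κ₀, δ, hfin, hν0, hκ, hδ, hrep, hdbl, huv⟩ := H2 β hβ s hs hs1 hsub L q k hq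
  refine ⟨ν, κ₀, δ, hfin, hν0, hκ, hδ, hrep, fun E hE hE1 => ?_, huv⟩
  have hx0 : 0 < max (s / ℓ) (4 / (L : ℝ)) := lt_max_of_lt_left (div_pos hs hℓ)
  have := hdbl (E / max (s / ℓ) (4 / (L : ℝ))) (max (s / ℓ) (4 / (L : ℝ))) (by rwa [le_div_iff₀ hx0, one_mul]) le_rfl (by rw [div_mul_cancel₀ E hx0.ne']; exact hE1)
  rwa [div_mul_cancel₀ E hx0.ne'] at this


end Summit.QuantumFields.YangMills.Theses.ThermodynamicCeilings
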